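import Summits.BirchSwinnertonDyer.BirchSwinnertonDyer.Theorems.ByReductionTypeAtTwoAdditivePotMultConjATwoNarrowTwo29240Residues
import Summits.BirchSwinnertonDyer.BirchSwinnertonDyer.Theorems.ByReductionTypeAtTwoFineSelmerConjAAtTwoAdditivePotGoodNarrowRankCertificate316LayerOneTotPos
import HarnessLib

/-!
# C4″ `AdditivePotMultOverKAtTwo` (item stmt-BirchSwinnertonDyer-22618), the (I1M′) input of the upper half on the `0 < Δ` rows:
# LAYER-TWO NARROW CERTIFICATE `d = 29240` (NON-monogenic cubic field), part TOTPOS — the unit `u₊` of `A₁ = ℚ(θ) ⊔ ℚ_1` is TOTALLY POSITIVE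
# (six located real places) and not a square, so `#(U⁺/U²)(A₁) ≥ 2` (the downstairs input `a = 1` of the Edgar–Mollin–Peterson door; KERNEL; rows 292400bq1)

Cell `bsd-2adic`, rung K4, seat `bsd-2adic-k4-w3` GEN 14 (explicit unit of director-bsd g16 (309)(7); `--supports stmt-BirchSwinnertonDyer-22618`).
HONEST FRAMING (D-0036/D-0054/D-0152): THEOREMS ONLY (no definition, no named fact, no `sorry`, no instance). The series `…NarrowTwo29240{Class, Field,
Dyadic, Residues, TotPos, Integers, Parity, SignsA/B/C, Units, Rows}` carries k4-w1 GEN 11's zero-hypothesis LAYER-TWO narrow certificate (row `261648q1`,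
`…NarrowRankCertificate316*`: `h(A₁)`, `h(A₂)` odd by genus theory with one dyadic non-norm unit, ONE totally positive non-square unit of `A₁ = ℚ(θ,√2)`,
ELEVEN sign-independent units of `A₂ = ℚ(θ,√(2+√2))`, k4-w2's Edgar–Mollin–Peterson door `a = 1, b = 11`, cruxlead-19573-w2's rung `m = 1`) to the
totally real cubic `2`-torsion field of discriminant `29240` (`X³ + (-50)X² + (747)X + (-3452)`) of the C4″ census rows 292400bq1 (eng-2 CERT-ADD-POTMULT-POS81-AB-E2:
`n₀ = 0`, `rank₂ Cl⁺ = [0,1,1]`, unit signature ranks `[3,5,11]`, `h = 1` at layers `0,1,2` — letter NARROW-EQUAL12, instrument grade `grh`; here KERNEL).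
All certificates were found by the seat's exact-arithmetic tools (`k4w3/gen13/tools`: GEN 12 `narrowcert/unitlib` + layer-two arithmetic `nf12/cert2`) and are CHECKED
HERE by the kernel. Statement (A) is NOT BSD: BSD₂ for these curves is not proved; C4″ / (I1M′) stay research-open; nothing booked; no row of 22618 changes tier
(pen RC-490 (4)); BSD is not proved by any of this.

References: [CoatesSujatha2005] Conj. A, Thm. 3.4; [Fukuda1994] Thm. 1 (2); [EdgarMollinPeterson1986] Thm. 2.1; [FrohlichTaylor1990] Ch. V §1 (1.8)–(1.13);
[Lang1990] Ch. 13 §4 Lemma 4.1; [Washington1997] §13.1, Prop. 13.2; [Cohen1993] §4.1.3, §6.3; [Marcus1977] Ch. 5 Thm. 22, 35–37; [Omeara1963] §63.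
-/

set_option autoImplicit false
-- sibling precedent: the directory name repeats the summit name
set_option linter.dupNamespace false

noncomputable section

open scoped Classical IntermediateField NumberField nonZeroDivisors Polynomial

namespace Summit.BirchSwinnertonDyer.BirchSwinnertonDyer.Theorems.AddKatoTwo

open Polynomial IsDedekindDomain NumberField Field IntermediateField
  Literature.NumberTheory.EllipticCurves Literature.NumberTheory.EllipticCurves.ZpExtension
  Literature.NumberTheory.IwasawaTheory Literature.NumberTheory.NumberFields
  Literature.NumberTheory.GaloisRepresentations Literature.Geometry.Kaehler.ComplexTorus

variable {θ : AlgebraicClosure ℚ}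

set_option linter.unusedSimpArgs false in
set_option maxHeartbeats 1600000 in
/-- **`#(U⁺/U²)(ℚ(θ) ⊔ ℚ_1) ≥ 2` for `θ³ + (-50)θ² + (747)θ + (-3452) = 0`** (`d = 29240`): the unit `u₊ = -15012757 + 803909 * ω - 210120 * γ + 1867894 * θ + 11285 * γ * ω - 100232 * θ * ω` of `ℤ[θ, γ, ω]` is totally
positive (six located real embeddings, linear interval arithmetic) and not a square (`…29240Residues`). KERNEL. [cite: FrohlichTaylor1990, Ch. V §1 (1.12), p. 164]
[cite: Cohen1993, §4.1.3] [cite: Washington1997, §13.1] -/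
theorem two_le_card_totPosUnitsModSq_adjoin_sup_layer_one_d29240 (hθ : aeval θ (Cubic.toPoly ⟨1, ((-50 : ℤ) : ℚ), ((747 : ℤ) : ℚ), ((-3452 : ℤ) : ℚ)⟩) = 0) :
    haveI : FiniteDimensional ℚ ↥ℚ⟮θ⟯ :=
      IntermediateField.adjoin.finiteDimensional ⟨_, Cubic.monic_of_a_eq_one', by rwa [← aeval_def]⟩
    haveI : FiniteDimensional ℚ ↥((CyclotomicZp.zpExtension 2).layer 1) := (CyclotomicZp.zpExtension 2).finiteDimensional_layer_holds 1
    haveI : NumberField ↥(ℚ⟮θ⟯ ⊔ (CyclotomicZp.zpExtension 2).layer 1) := NumberField.mk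
    2 ≤ Nat.card (TotPosUnitsModSq ↥(ℚ⟮θ⟯ ⊔ (CyclotomicZp.zpExtension 2).layer 1)) := by
  haveI : FiniteDimensional ℚ ↥ℚ⟮θ⟯ :=
    IntermediateField.adjoin.finiteDimensional ⟨_, Cubic.monic_of_a_eq_one', by rwa [← aeval_def]⟩
  haveI : FiniteDimensional ℚ ↥((CyclotomicZp.zpExtension 2).layer 1) := (CyclotomicZp.zpExtension 2).finiteDimensional_layer_holds 1
  haveI : NumberField ↥ℚ⟮θ⟯ := NumberField.mk
  haveI : NumberField ↥(ℚ⟮θ⟯ ⊔ (CyclotomicZp.zpExtension 2).layer 1) := NumberField.mk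
  obtain ⟨hreal, hfinA, h3⟩ := layer_one_basics irreducible_cubic_d29240p hθ (isTotallyReal_adjoin_d29240p hθ)
  haveI := hreal
  obtain ⟨t, ht, ht2⟩ := CyclotomicZp.exists_mem_layer_one_sq_eq_two_zpExtension
  have hKA : ℚ⟮θ⟯ ≤ ℚ⟮θ⟯ ⊔ (CyclotomicZp.zpExtension 2).layer 1 := le_sup_left
  have htA : t ∈ ℚ⟮θ⟯ ⊔ (CyclotomicZp.zpExtension 2).layer 1 := (le_sup_right : (CyclotomicZp.zpExtension 2).layer 1 ≤ _) ht
  set t' : ↥(ℚ⟮θ⟯ ⊔ (CyclotomicZp.zpExtension 2).layer 1) := ⟨t, htA⟩ with ht'def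
  set θ' : ↥(ℚ⟮θ⟯ ⊔ (CyclotomicZp.zpExtension 2).layer 1) := inclusion hKA (AdjoinSimple.gen ℚ θ) with hθ'def
  obtain ⟨ρ₀, ρ₁, ρ₂, x₀, x₁, x₂, hρ₀, hρ₁, hρ₂, hl₀, hu₀, hl₁, hu₁, hl₂, hu₂⟩ := exists_three_ringHom_adjoin_d29240p hθ
  have hs2l : ((1414213562373095048801688724209 : ℝ) / 1000000000000000000000000000000) < Real.sqrt 2 :=
    (Real.lt_sqrt (by norm_num)).mpr (by norm_num)
  have hs2u : Real.sqrt 2 < ((141421356237309504880168872421 : ℝ) / 100000000000000000000000000000) :=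
    (Real.sqrt_lt' (by norm_num)).mpr (by norm_num)
  have hysq : (Real.sqrt 2) ^ 2 = 2 := Real.sq_sqrt (by norm_num)
  obtain ⟨bA, gA, xA, -, -, hbAval, hgAval, -, hxval, RbA, RbgA, RgA, RxA, -, -, -, -, -, -, -, -, -, -⟩ := layer_one_dyadic_d29240 hθ ht ht2
  have RbA3 : -3452 + 747 * bA - 50 * bA ^ 2 + bA ^ 3 = 0 := by linear_combination ((-54 : 𝓞 ↥(ℚ⟮θ⟯ ⊔ (CyclotomicZp.zpExtension 2).layer 1)) + (1 : 𝓞 ↥(ℚ⟮θ⟯ ⊔ (CyclotomicZp.zpExtension 2).layer 1)) * bA) * RbA + ((5 : 𝓞 ↥(ℚ⟮θ⟯ ⊔ (CyclotomicZp.zpExtension 2).layer 1))) * RbgA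
  have hθ'rel : -3452 + 747 * θ' - 50 * θ' ^ 2 + θ' ^ 3 = 0 := by
    have h := congrArg (algebraMap (𝓞 ↥(ℚ⟮θ⟯ ⊔ (CyclotomicZp.zpExtension 2).layer 1)) ↥(ℚ⟮θ⟯ ⊔ (CyclotomicZp.zpExtension 2).layer 1)) RbA3
    simp only [map_add, map_sub, map_mul, map_pow, map_zero, map_ofNat, map_zero, map_neg, map_one] at h
    rw [← NumberField.RingOfIntegers.coe_eq_algebraMap, hbAval] at h; exact h
  have hxval' : (xA : ↥(ℚ⟮θ⟯ ⊔ (CyclotomicZp.zpExtension 2).layer 1)) = ((8 + 9 * θ' + θ' ^ 2) + t' * (158 - 26 * θ' + θ' ^ 2)) / 10 := hxval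
  have hgval' : (gA : ↥(ℚ⟮θ⟯ ⊔ (CyclotomicZp.zpExtension 2).layer 1)) = (3 + 4 * θ' + θ' ^ 2) / 5 := hgAval
  have hval : ∀ (σ : ↥(ℚ⟮θ⟯ ⊔ (CyclotomicZp.zpExtension 2).layer 1) →+* ℝ) (x y : ℝ), σ θ' = x → σ t' = y →
      σ (algebraMap (𝓞 ↥(ℚ⟮θ⟯ ⊔ (CyclotomicZp.zpExtension 2).layer 1)) ↥(ℚ⟮θ⟯ ⊔ (CyclotomicZp.zpExtension 2).layer 1) bA) = x ∧ σ (algebraMap (𝓞 ↥(ℚ⟮θ⟯ ⊔ (CyclotomicZp.zpExtension 2).layer 1)) ↥(ℚ⟮θ⟯ ⊔ (CyclotomicZp.zpExtension 2).layer 1) gA) = (3 + 4 * x + x ^ 2) / 5 ∧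
      σ (algebraMap (𝓞 ↥(ℚ⟮θ⟯ ⊔ (CyclotomicZp.zpExtension 2).layer 1)) ↥(ℚ⟮θ⟯ ⊔ (CyclotomicZp.zpExtension 2).layer 1) xA) = ((8 + 9 * x + x ^ 2) + y * (158 - 26 * x + x ^ 2)) / 10 ∧ -3452 + 747 * x - 50 * x ^ 2 + x ^ 3 = 0 := by
    intro σ x y hx hy
    have hb : σ (algebraMap _ _ bA) = x := by rw [← NumberField.RingOfIntegers.coe_eq_algebraMap, hbAval, hx]
    have hxrel : -3452 + 747 * x - 50 * x ^ 2 + x ^ 3 = 0 := by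
      have h := congrArg σ hθ'rel
      simp only [map_add, map_sub, map_mul, map_pow, map_zero, map_ofNat, map_zero, map_neg, map_one, hx] at h; exact h
    refine ⟨hb, ?_, ?_, hxrel⟩
    · rw [← NumberField.RingOfIntegers.coe_eq_algebraMap, hgval']
      simp only [map_add, map_sub, map_mul, map_pow, map_zero, map_ofNat, map_neg, map_one, map_div₀, hx]
    · rw [← NumberField.RingOfIntegers.coe_eq_algebraMap, hxval']
      simp only [map_add, map_sub, map_mul, map_pow, map_zero, map_ofNat, map_neg, map_one, map_div₀, hy, hx]
  obtain ⟨hid, -, -, -, -⟩ := layer_one_uplus_ids_d29240 bA gA xA RbA RbgA RgA RxA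
  set eU : (𝓞 ↥(ℚ⟮θ⟯ ⊔ (CyclotomicZp.zpExtension 2).layer 1))ˣ := Units.mkOfMulEqOne _ _ hid with heUdef
  obtain ⟨σ₁, hσ₁K, hσ₁t⟩ := exists_ringHom_sup_layer_one irreducible_cubic_d29240p hθ (isTotallyReal_adjoin_d29240p hθ) ht ht2 ρ₀ (Real.sqrt 2) (Or.inl rfl)
  have hσ₁θ : σ₁ θ' = x₀ := by rw [hθ'def, hσ₁K, hρ₀]
  obtain ⟨hσ₁b, hσ₁g, hσ₁x, hσ₁r⟩ := hval σ₁ x₀ (Real.sqrt 2) hσ₁θ hσ₁t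
  obtain ⟨σ₂, hσ₂K, hσ₂t⟩ := exists_ringHom_sup_layer_one irreducible_cubic_d29240p hθ (isTotallyReal_adjoin_d29240p hθ) ht ht2 ρ₀ (-Real.sqrt 2) (Or.inr rfl)
  have hσ₂θ : σ₂ θ' = x₀ := by rw [hθ'def, hσ₂K, hρ₀]
  obtain ⟨hσ₂b, hσ₂g, hσ₂x, hσ₂r⟩ := hval σ₂ x₀ (-Real.sqrt 2) hσ₂θ hσ₂t
  obtain ⟨σ₃, hσ₃K, hσ₃t⟩ := exists_ringHom_sup_layer_one irreducible_cubic_d29240p hθ (isTotallyReal_adjoin_d29240p hθ) ht ht2 ρ₁ (Real.sqrt 2) (Or.inl rfl)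
  have hσ₃θ : σ₃ θ' = x₁ := by rw [hθ'def, hσ₃K, hρ₁]
  obtain ⟨hσ₃b, hσ₃g, hσ₃x, hσ₃r⟩ := hval σ₃ x₁ (Real.sqrt 2) hσ₃θ hσ₃t
  obtain ⟨σ₄, hσ₄K, hσ₄t⟩ := exists_ringHom_sup_layer_one irreducible_cubic_d29240p hθ (isTotallyReal_adjoin_d29240p hθ) ht ht2 ρ₁ (-Real.sqrt 2) (Or.inr rfl)
  have hσ₄θ : σ₄ θ' = x₁ := by rw [hθ'def, hσ₄K, hρ₁]
  obtain ⟨hσ₄b, hσ₄g, hσ₄x, hσ₄r⟩ := hval σ₄ x₁ (-Real.sqrt 2) hσ₄θ hσ₄t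
  obtain ⟨σ₅, hσ₅K, hσ₅t⟩ := exists_ringHom_sup_layer_one irreducible_cubic_d29240p hθ (isTotallyReal_adjoin_d29240p hθ) ht ht2 ρ₂ (Real.sqrt 2) (Or.inl rfl)
  have hσ₅θ : σ₅ θ' = x₂ := by rw [hθ'def, hσ₅K, hρ₂]
  obtain ⟨hσ₅b, hσ₅g, hσ₅x, hσ₅r⟩ := hval σ₅ x₂ (Real.sqrt 2) hσ₅θ hσ₅t
  obtain ⟨σ₆, hσ₆K, hσ₆t⟩ := exists_ringHom_sup_layer_one irreducible_cubic_d29240p hθ (isTotallyReal_adjoin_d29240p hθ) ht ht2 ρ₂ (-Real.sqrt 2) (Or.inr rfl)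
  have hσ₆θ : σ₆ θ' = x₂ := by rw [hθ'def, hσ₆K, hρ₂]
  obtain ⟨hσ₆b, hσ₆g, hσ₆x, hσ₆r⟩ := hval σ₆ x₂ (-Real.sqrt 2) hσ₆θ hσ₆t
  obtain ⟨hXXl₀, hXXu₀⟩ := Ioo_mul_bounds (by norm_num) (by norm_num) hl₀ hu₀ hl₀ hu₀
  obtain ⟨hYXl₀, hYXu₀⟩ := Ioo_mul_bounds (by norm_num) (by norm_num) hs2l hs2u hl₀ hu₀
  obtain ⟨hYXXl₀, hYXXu₀⟩ := Ioo_mul_bounds (by norm_num) (by norm_num) hs2l hs2u hXXl₀ hXXu₀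
  obtain ⟨hXXl₁, hXXu₁⟩ := Ioo_mul_bounds (by norm_num) (by norm_num) hl₁ hu₁ hl₁ hu₁
  obtain ⟨hYXl₁, hYXu₁⟩ := Ioo_mul_bounds (by norm_num) (by norm_num) hs2l hs2u hl₁ hu₁
  obtain ⟨hYXXl₁, hYXXu₁⟩ := Ioo_mul_bounds (by norm_num) (by norm_num) hs2l hs2u hXXl₁ hXXu₁
  obtain ⟨hXXl₂, hXXu₂⟩ := Ioo_mul_bounds (by norm_num) (by norm_num) hl₂ hu₂ hl₂ hu₂
  obtain ⟨hYXl₂, hYXu₂⟩ := Ioo_mul_bounds (by norm_num) (by norm_num) hs2l hs2u hl₂ hu₂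
  obtain ⟨hYXXl₂, hYXXu₂⟩ := Ioo_mul_bounds (by norm_num) (by norm_num) hs2l hs2u hXXl₂ hXXu₂
  have sσ₁ : 0 < σ₁ ((eU : 𝓞 ↥(ℚ⟮θ⟯ ⊔ (CyclotomicZp.zpExtension 2).layer 1)) : ↥(ℚ⟮θ⟯ ⊔ (CyclotomicZp.zpExtension 2).layer 1)) := by
    have hv : σ₁ ((eU : 𝓞 ↥(ℚ⟮θ⟯ ⊔ (CyclotomicZp.zpExtension 2).layer 1)) : ↥(ℚ⟮θ⟯ ⊔ (CyclotomicZp.zpExtension 2).layer 1)) = ((-30191 : ℝ) / 5) + ((119584 : ℝ) / 5) * Real.sqrt 2 + ((12259 : ℝ) / 10) * x₀ + ((-15428 : ℝ) / 5) * (Real.sqrt 2 * x₀) + ((-369 : ℝ) / 10) * (x₀ * x₀) + ((811 : ℝ) / 10) * (Real.sqrt 2 * (x₀ * x₀)) := by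
      rw [heUdef, Units.val_mkOfMulEqOne, NumberField.RingOfIntegers.coe_eq_algebraMap]
      simp only [map_add, map_sub, map_mul, map_pow, map_zero, map_neg, map_one, map_ofNat, hσ₁b, hσ₁g, hσ₁x]
      linear_combination (((41959 : ℝ) / 10) + ((-18518 : ℝ) / 5) * (Real.sqrt 2) + ((2257 : ℝ) / 10) * x₀ + ((2257 : ℝ) / 10) * x₀ * (Real.sqrt 2)) * hσ₁r
    rw [hv]; linarith [hXXl₀, hXXu₀, hYXl₀, hYXu₀, hYXXl₀, hYXXu₀, hs2l, hs2u, hl₀, hu₀]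
  have sσ₂ : 0 < σ₂ ((eU : 𝓞 ↥(ℚ⟮θ⟯ ⊔ (CyclotomicZp.zpExtension 2).layer 1)) : ↥(ℚ⟮θ⟯ ⊔ (CyclotomicZp.zpExtension 2).layer 1)) := by
    have hv : σ₂ ((eU : 𝓞 ↥(ℚ⟮θ⟯ ⊔ (CyclotomicZp.zpExtension 2).layer 1)) : ↥(ℚ⟮θ⟯ ⊔ (CyclotomicZp.zpExtension 2).layer 1)) = ((-30191 : ℝ) / 5) + ((-119584 : ℝ) / 5) * Real.sqrt 2 + ((12259 : ℝ) / 10) * x₀ + ((15428 : ℝ) / 5) * (Real.sqrt 2 * x₀) + ((-369 : ℝ) / 10) * (x₀ * x₀) + ((-811 : ℝ) / 10) * (Real.sqrt 2 * (x₀ * x₀)) := by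
      rw [heUdef, Units.val_mkOfMulEqOne, NumberField.RingOfIntegers.coe_eq_algebraMap]
      simp only [map_add, map_sub, map_mul, map_pow, map_zero, map_neg, map_one, map_ofNat, hσ₂b, hσ₂g, hσ₂x]
      linear_combination (((41959 : ℝ) / 10) + ((18518 : ℝ) / 5) * (Real.sqrt 2) + ((2257 : ℝ) / 10) * x₀ + ((-2257 : ℝ) / 10) * x₀ * (Real.sqrt 2)) * hσ₂r
    rw [hv]; linarith [hXXl₀, hXXu₀, hYXl₀, hYXu₀, hYXXl₀, hYXXu₀, hs2l, hs2u, hl₀, hu₀]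
  have sσ₃ : 0 < σ₃ ((eU : 𝓞 ↥(ℚ⟮θ⟯ ⊔ (CyclotomicZp.zpExtension 2).layer 1)) : ↥(ℚ⟮θ⟯ ⊔ (CyclotomicZp.zpExtension 2).layer 1)) := by
    have hv : σ₃ ((eU : 𝓞 ↥(ℚ⟮θ⟯ ⊔ (CyclotomicZp.zpExtension 2).layer 1)) : ↥(ℚ⟮θ⟯ ⊔ (CyclotomicZp.zpExtension 2).layer 1)) = ((-30191 : ℝ) / 5) + ((119584 : ℝ) / 5) * Real.sqrt 2 + ((12259 : ℝ) / 10) * x₁ + ((-15428 : ℝ) / 5) * (Real.sqrt 2 * x₁) + ((-369 : ℝ) / 10) * (x₁ * x₁) + ((811 : ℝ) / 10) * (Real.sqrt 2 * (x₁ * x₁)) := by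
      rw [heUdef, Units.val_mkOfMulEqOne, NumberField.RingOfIntegers.coe_eq_algebraMap]
      simp only [map_add, map_sub, map_mul, map_pow, map_zero, map_neg, map_one, map_ofNat, hσ₃b, hσ₃g, hσ₃x]
      linear_combination (((41959 : ℝ) / 10) + ((-18518 : ℝ) / 5) * (Real.sqrt 2) + ((2257 : ℝ) / 10) * x₁ + ((2257 : ℝ) / 10) * x₁ * (Real.sqrt 2)) * hσ₃r
    rw [hv]; linarith [hXXl₁, hXXu₁, hYXl₁, hYXu₁, hYXXl₁, hYXXu₁, hs2l, hs2u, hl₁, hu₁]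
  have sσ₄ : 0 < σ₄ ((eU : 𝓞 ↥(ℚ⟮θ⟯ ⊔ (CyclotomicZp.zpExtension 2).layer 1)) : ↥(ℚ⟮θ⟯ ⊔ (CyclotomicZp.zpExtension 2).layer 1)) := by
    have hv : σ₄ ((eU : 𝓞 ↥(ℚ⟮θ⟯ ⊔ (CyclotomicZp.zpExtension 2).layer 1)) : ↥(ℚ⟮θ⟯ ⊔ (CyclotomicZp.zpExtension 2).layer 1)) = ((-30191 : ℝ) / 5) + ((-119584 : ℝ) / 5) * Real.sqrt 2 + ((12259 : ℝ) / 10) * x₁ + ((15428 : ℝ) / 5) * (Real.sqrt 2 * x₁) + ((-369 : ℝ) / 10) * (x₁ * x₁) + ((-811 : ℝ) / 10) * (Real.sqrt 2 * (x₁ * x₁)) := by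
      rw [heUdef, Units.val_mkOfMulEqOne, NumberField.RingOfIntegers.coe_eq_algebraMap]
      simp only [map_add, map_sub, map_mul, map_pow, map_zero, map_neg, map_one, map_ofNat, hσ₄b, hσ₄g, hσ₄x]
      linear_combination (((41959 : ℝ) / 10) + ((18518 : ℝ) / 5) * (Real.sqrt 2) + ((2257 : ℝ) / 10) * x₁ + ((-2257 : ℝ) / 10) * x₁ * (Real.sqrt 2)) * hσ₄r
    rw [hv]; linarith [hXXl₁, hXXu₁, hYXl₁, hYXu₁, hYXXl₁, hYXXu₁, hs2l, hs2u, hl₁, hu₁]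
  have sσ₅ : 0 < σ₅ ((eU : 𝓞 ↥(ℚ⟮θ⟯ ⊔ (CyclotomicZp.zpExtension 2).layer 1)) : ↥(ℚ⟮θ⟯ ⊔ (CyclotomicZp.zpExtension 2).layer 1)) := by
    have hv : σ₅ ((eU : 𝓞 ↥(ℚ⟮θ⟯ ⊔ (CyclotomicZp.zpExtension 2).layer 1)) : ↥(ℚ⟮θ⟯ ⊔ (CyclotomicZp.zpExtension 2).layer 1)) = ((-30191 : ℝ) / 5) + ((119584 : ℝ) / 5) * Real.sqrt 2 + ((12259 : ℝ) / 10) * x₂ + ((-15428 : ℝ) / 5) * (Real.sqrt 2 * x₂) + ((-369 : ℝ) / 10) * (x₂ * x₂) + ((811 : ℝ) / 10) * (Real.sqrt 2 * (x₂ * x₂)) := by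
      rw [heUdef, Units.val_mkOfMulEqOne, NumberField.RingOfIntegers.coe_eq_algebraMap]
      simp only [map_add, map_sub, map_mul, map_pow, map_zero, map_neg, map_one, map_ofNat, hσ₅b, hσ₅g, hσ₅x]
      linear_combination (((41959 : ℝ) / 10) + ((-18518 : ℝ) / 5) * (Real.sqrt 2) + ((2257 : ℝ) / 10) * x₂ + ((2257 : ℝ) / 10) * x₂ * (Real.sqrt 2)) * hσ₅r
    rw [hv]; linarith [hXXl₂, hXXu₂, hYXl₂, hYXu₂, hYXXl₂, hYXXu₂, hs2l, hs2u, hl₂, hu₂]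
  have sσ₆ : 0 < σ₆ ((eU : 𝓞 ↥(ℚ⟮θ⟯ ⊔ (CyclotomicZp.zpExtension 2).layer 1)) : ↥(ℚ⟮θ⟯ ⊔ (CyclotomicZp.zpExtension 2).layer 1)) := by
    have hv : σ₆ ((eU : 𝓞 ↥(ℚ⟮θ⟯ ⊔ (CyclotomicZp.zpExtension 2).layer 1)) : ↥(ℚ⟮θ⟯ ⊔ (CyclotomicZp.zpExtension 2).layer 1)) = ((-30191 : ℝ) / 5) + ((-119584 : ℝ) / 5) * Real.sqrt 2 + ((12259 : ℝ) / 10) * x₂ + ((15428 : ℝ) / 5) * (Real.sqrt 2 * x₂) + ((-369 : ℝ) / 10) * (x₂ * x₂) + ((-811 : ℝ) / 10) * (Real.sqrt 2 * (x₂ * x₂)) := by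
      rw [heUdef, Units.val_mkOfMulEqOne, NumberField.RingOfIntegers.coe_eq_algebraMap]
      simp only [map_add, map_sub, map_mul, map_pow, map_zero, map_neg, map_one, map_ofNat, hσ₆b, hσ₆g, hσ₆x]
      linear_combination (((41959 : ℝ) / 10) + ((18518 : ℝ) / 5) * (Real.sqrt 2) + ((2257 : ℝ) / 10) * x₂ + ((-2257 : ℝ) / 10) * x₂ * (Real.sqrt 2)) * hσ₆r
    rw [hv]; linarith [hXXl₂, hXXu₂, hYXl₂, hYXu₂, hYXXl₂, hYXXu₂, hs2l, hs2u, hl₂, hu₂]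
  have hcardA : Fintype.card (↥(ℚ⟮θ⟯ ⊔ (CyclotomicZp.zpExtension 2).layer 1) →+* ℝ) = 6 := by rw [card_realEmbeddings, hfinA]
  have hneθ : ∀ {φ ψ : ↥(ℚ⟮θ⟯ ⊔ (CyclotomicZp.zpExtension 2).layer 1) →+* ℝ}, φ θ' ≠ ψ θ' → φ ≠ ψ := by
    intro φ ψ h hφψ; exact h (by rw [hφψ])
  have hnet : ∀ {φ ψ : ↥(ℚ⟮θ⟯ ⊔ (CyclotomicZp.zpExtension 2).layer 1) →+* ℝ}, φ t' ≠ ψ t' → φ ≠ ψ := by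
    intro φ ψ h hφψ; exact h (by rw [hφψ])
  have hss : Real.sqrt 2 ≠ -Real.sqrt 2 := by intro h; linarith [hs2l]
  have huniv : (Finset.univ : Finset (↥(ℚ⟮θ⟯ ⊔ (CyclotomicZp.zpExtension 2).layer 1) →+* ℝ)) = {σ₁, σ₂, σ₃, σ₄, σ₅, σ₆} := by
    symm
    apply Finset.eq_of_subset_of_card_le (Finset.subset_univ _)
    rw [Finset.card_univ, hcardA]
    have h12 : σ₁ ≠ σ₂ := hnet (by rw [hσ₁t, hσ₂t]; exact hss)
    have h13 : σ₁ ≠ σ₃ := hneθ (by rw [hσ₁θ, hσ₃θ]; intro h; linarith)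
    have h14 : σ₁ ≠ σ₄ := hneθ (by rw [hσ₁θ, hσ₄θ]; intro h; linarith)
    have h15 : σ₁ ≠ σ₅ := hneθ (by rw [hσ₁θ, hσ₅θ]; intro h; linarith)
    have h16 : σ₁ ≠ σ₆ := hneθ (by rw [hσ₁θ, hσ₆θ]; intro h; linarith)
    have h23 : σ₂ ≠ σ₃ := hneθ (by rw [hσ₂θ, hσ₃θ]; intro h; linarith)
    have h24 : σ₂ ≠ σ₄ := hneθ (by rw [hσ₂θ, hσ₄θ]; intro h; linarith)
    have h25 : σ₂ ≠ σ₅ := hneθ (by rw [hσ₂θ, hσ₅θ]; intro h; linarith)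
    have h26 : σ₂ ≠ σ₆ := hneθ (by rw [hσ₂θ, hσ₆θ]; intro h; linarith)
    have h34 : σ₃ ≠ σ₄ := hnet (by rw [hσ₃t, hσ₄t]; exact hss)
    have h35 : σ₃ ≠ σ₅ := hneθ (by rw [hσ₃θ, hσ₅θ]; intro h; linarith)
    have h36 : σ₃ ≠ σ₆ := hneθ (by rw [hσ₃θ, hσ₆θ]; intro h; linarith)
    have h45 : σ₄ ≠ σ₅ := hneθ (by rw [hσ₄θ, hσ₅θ]; intro h; linarith)
    have h46 : σ₄ ≠ σ₆ := hneθ (by rw [hσ₄θ, hσ₆θ]; intro h; linarith)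
    have h56 : σ₅ ≠ σ₆ := hnet (by rw [hσ₅t, hσ₆t]; exact hss)
    rw [Finset.card_insert_of_notMem (by simp [h12, h13, h14, h15, h16]), Finset.card_insert_of_notMem (by simp [h23, h24, h25, h26]),
      Finset.card_insert_of_notMem (by simp [h34, h35, h36]), Finset.card_insert_of_notMem (by simp [h45, h46]),
      Finset.card_pair h56]
  have hpos : ∀ σ : ↥(ℚ⟮θ⟯ ⊔ (CyclotomicZp.zpExtension 2).layer 1) →+* ℝ,
      0 < σ ((eU : 𝓞 ↥(ℚ⟮θ⟯ ⊔ (CyclotomicZp.zpExtension 2).layer 1)) : ↥(ℚ⟮θ⟯ ⊔ (CyclotomicZp.zpExtension 2).layer 1)) := by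
    intro σ
    have hσ : σ ∈ ({σ₁, σ₂, σ₃, σ₄, σ₅, σ₆} : Finset (↥(ℚ⟮θ⟯ ⊔ (CyclotomicZp.zpExtension 2).layer 1) →+* ℝ)) := huniv ▸ Finset.mem_univ σ
    simp only [Finset.mem_insert, Finset.mem_singleton] at hσ
    rcases hσ with rfl | rfl | rfl | rfl | rfl | rfl
    · exact sσ₁
    · exact sσ₂
    · exact sσ₃
    · exact sσ₄
    · exact sσ₅
    · exact sσ₆
  have ht'2 : t' ^ 2 = 2 := by
    apply (algebraMap ↥(ℚ⟮θ⟯ ⊔ (CyclotomicZp.zpExtension 2).layer 1) (AlgebraicClosure ℚ)).injective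
    rw [map_pow, map_ofNat]; exact ht2
  have heUval : ((eU : 𝓞 ↥(ℚ⟮θ⟯ ⊔ (CyclotomicZp.zpExtension 2).layer 1)) : ↥(ℚ⟮θ⟯ ⊔ (CyclotomicZp.zpExtension 2).layer 1)) =
      (inclusion (le_sup_left : ℚ⟮θ⟯ ≤ ℚ⟮θ⟯ ⊔ (CyclotomicZp.zpExtension 2).layer 1) (-60382 + 12259 * AdjoinSimple.gen ℚ θ - 369 * AdjoinSimple.gen ℚ θ ^ 2) + ⟨t, (le_sup_right : (CyclotomicZp.zpExtension 2).layer 1 ≤ _) ht⟩ * inclusion (le_sup_left : ℚ⟮θ⟯ ≤ ℚ⟮θ⟯ ⊔ (CyclotomicZp.zpExtension 2).layer 1) (239168 - 30856 * AdjoinSimple.gen ℚ θ + 811 * AdjoinSimple.gen ℚ θ ^ 2)) / 10 := by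
    have hbA' : algebraMap (𝓞 ↥(ℚ⟮θ⟯ ⊔ (CyclotomicZp.zpExtension 2).layer 1)) ↥(ℚ⟮θ⟯ ⊔ (CyclotomicZp.zpExtension 2).layer 1) bA = θ' := hbAval
    have hgA' : algebraMap (𝓞 ↥(ℚ⟮θ⟯ ⊔ (CyclotomicZp.zpExtension 2).layer 1)) ↥(ℚ⟮θ⟯ ⊔ (CyclotomicZp.zpExtension 2).layer 1) gA = (3 + 4 * θ' + θ' ^ 2) / 5 := by
      rw [← NumberField.RingOfIntegers.coe_eq_algebraMap, hgval']
    have hxA' : algebraMap (𝓞 ↥(ℚ⟮θ⟯ ⊔ (CyclotomicZp.zpExtension 2).layer 1)) ↥(ℚ⟮θ⟯ ⊔ (CyclotomicZp.zpExtension 2).layer 1) xA = ((8 + 9 * θ' + θ' ^ 2) + t' * (158 - 26 * θ' + θ' ^ 2)) / 10 := by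
      rw [← NumberField.RingOfIntegers.coe_eq_algebraMap, hxval']
    rw [heUdef, Units.val_mkOfMulEqOne, NumberField.RingOfIntegers.coe_eq_algebraMap]
    simp only [map_add, map_sub, map_mul, map_pow, map_zero, map_neg, map_one, map_ofNat, hbA', hgA', hxA', ← hθ'def]
    change _ = (_ + t' * _) / _
    linear_combination (((41959 : ↥(ℚ⟮θ⟯ ⊔ (CyclotomicZp.zpExtension 2).layer 1)) / 10) + ((-18518 : ↥(ℚ⟮θ⟯ ⊔ (CyclotomicZp.zpExtension 2).layer 1)) / 5) * t' + ((2257 : ↥(ℚ⟮θ⟯ ⊔ (CyclotomicZp.zpExtension 2).layer 1)) / 10) * θ' + ((2257 : ↥(ℚ⟮θ⟯ ⊔ (CyclotomicZp.zpExtension 2).layer 1)) / 10) * θ' * t') * hθ'rel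
  have hns := not_exists_unit_sq_eq_uplus_sup_layer_one_d29240 hθ ht ht2 eU heUval
  exact two_le_card_totPosUnitsModSq_of_not_sq eU hpos hns

end Summit.BirchSwinnertonDyer.BirchSwinnertonDyer.Theorems.AddKatoTwo

end
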